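import Summits.BirchSwinnertonDyer.BirchSwinnertonDyer.Theorems.ManinLocalTwoThreeManinOddAtFourRootNumberSplit
import Summits.BirchSwinnertonDyer.BirchSwinnertonDyer.Theorems.ManinLocalTwoThreeFullTwoTorsionIndexFour
import Summits.BirchSwinnertonDyer.BirchSwinnertonDyer.Theorems.ManinLocalTwoThreeSqRootWitnessLaw
import Summits.BirchSwinnertonDyer.BirchSwinnertonDyer.Theorems.ManinLocalTwoThreeUnboundedDenominatorsWeightAlgIntOfCDT
import Summits.BirchSwinnertonDyer.BirchSwinnertonDyer.Theorems.ManinLocalTwoThreeStevensCurveOfCuspZero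
import Summits.BirchSwinnertonDyer.Rank1Residual.ManinAdditive.EvenKummerShimuraNodes
import HarnessLib

/-!
# C2 — THE KERNEL SPLIT: on the gain locus the cuspidal-Kummer laws 6a‴ / 6b-res are replaced by two rows about STEVENS' CURVE —
# «index ≠ 4» (E-an-152b) and «a blind rational `2`-torsion point exists» (E-an-152♭, a weakening of E-an-152) — fed by UDC₂ for EVERY rational root
(route `ManinLocalTwoThree`, deciding crux C2 `ManinOddAtFour` stmt-BirchSwinnertonDyer-22967; cell bsd-f2-manin, prover p3 gen 18;
`--supports stmt-BirchSwinnertonDyer-22967`; a v27-candidate composition — sequel to the Stevens split `…ManinOddAtFourStevensSplit` (p747777);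
engines: p2 g19's AN2₂ `UDCTwo.sqRootWitnessLaw` (p747828) and `periodLatticeGamma1_ne_of_two_dvd_of_CDT_algInt`, the LEAD's
`FullTwoTorsion.not_two_dvd_maninConstant_of_two_roots_of_not_indexFour` (p1 g18), -an g42's B-rows `KummerShimuraTwo.ShimuraIndexNeFourAtFourB` /
`ShimuraKernelBlindAtFourB` (T-an-58 leaf `…ManinAdditive.EvenKummerShimuraNodes`))

THE ARGUMENT on the gain locus G (`Λ₁(f) ≠ Λ₀(f)`, lattice-optimal `X₀(N)`-datum of a globally minimal `W` written with `a₁ = a₃ = 0`, `4 ∣ N`, core binders,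
`{∞,0}_f ∉ Λ₀(f)` from Θ's contrapositive), ASSUMING `2 ∣ c`:
* if `Λ₁(f) = 2Λ₀(f)` (index `4`): contradiction with the row **I4 = E-an-152b|_G** («index ≠ 4 on the gain locus»);
* else (`2Λ₀ ⊆ Λ₁`, Ling–Oesterlé) the row **K♭ = E-an-152♭|_G** («an index-`2` gain class has a BLIND rational `2`-division root», E-an-152 with its
  `℘`-clause dropped) gives a blind integral root `E`; then EITHER `W` has a second rational root `e ≠ E` — and UDC₂ applied to BOTH roots
  (`2 ∣ c` ⟹ both σ-square roots are `Γ₁(N)`-periodic ⟹ `Λ₁ = 2Λ₀`, the LEAD's `FullTwoTorsion` file on p2's AN2₂) contradicts I4 — OR `E` is the only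
  rational root, so `W` is TOTALLY BLIND and the v23 blind road (`not_two_dvd_maninConstant_of_katoFactAt₁_of_allBlind`: F★'s transfer `|c₀| = |c₁|` +
  the Γ₁ Kato lever) with the row **6♭‴|_G** (Kato–Néron integrality at the `X₁(N)`-optimal curve of blind gain classes) gives `2 ∤ c`.
The locus `Λ₁(f) = Λ₀(f)` is closed by p2's `periodLatticeGamma1_ne_of_two_dvd_of_CDT_algInt` (CDT alone), the irreducible locus by F♯ — as in v26.
So the cuspidal-Kummer certificate rows 6a‴ (`CuspidalKummerRepresentativeOnCore`, generalized-Ogg type, plain-`η` form hedged by -an at `16 ∣ N`) and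
6b-res are NOT consumed: **v27's law stubs = {E-an-152b|_G, E-an-152♭|_G, 6♭‴|_G}**, three statements about Stevens' curve on gain classes, all census-clean
(es E15 / -an §87: 21 gain classes at `16 ∣ N`, `N ≤ 80153`, all index `2`; the kernel root is blind 19/19 at `4 ∣ N ≤ 2000`).
THEOREMS: §1 `not_two_dvd_maninConstant_of_kernelLawsG_core` (datum level, `4 ∣ N`, abstract UDC₂ inputs `hEven` / `hTwoRoots`), §2 `maninOddAtSixteenCore_of_v27`,
`maninOddAtFour_of_katoFact_udcTwo_kernelLawsG` (route decl, abstract), §3 `exists_mem_periodLatticeGamma1_ne_two_mul_of_not_indexFour`, the restriction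
edges `indexNeFourG_of_B` / `blindRootG_of_kernelBlindB` from -an's B-rows, and the instantiations **`maninOddAtFour_of_katoFact_CDT_kernelLawsG`** (route decl
BY NAME from F♯, F★, F♮, CES, F-es-21♭K, CDT-algInt and the three G-rows INLINE) and **`maninOddAtFour_of_katoFact_CDT_kernelRowsB`** (the same with -an's NAMED
rows `ShimuraIndexNeFourAtFourB`, `ShimuraKernelBlindAtFourB` and 6♭‴|_G).
HONEST FRAMING.  CONDITIONAL reduction; E-an-152b, E-an-152(♭), 6♭‴ are OPEN cell rows; CDT and the cusp/Kato facts are printed, not proved in the tree;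
C2, Manin's conjecture and BSD are NOT proved.  No definitions, no sorry.
[cite: Kato2004Asterisque, Thm. 12.5 (1) (p. 221)] [cite: ConradEdixhovenStein2003, §6.1.2 and §6.2] [cite: Stevens1982, Thm. 1.3.1] [cite: Stevens1989, §2]
[cite: KurthLong2008, Prop. 18] [cite: CalegariDimitrovTang2025, Thm. 1.0.1 and Remarks 58–59] [cite: LingOesterle1991, Thm. 6]
-/

set_option autoImplicit false
-- lint-debt: the directory name repeats the summit name (sibling precedent `ManinLocalTwoThreeManinOddAtFourStevensSplit.lean`)
set_option linter.dupNamespace false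

noncomputable section

open scoped Classical MatrixGroups ModularForm NumberField PeriodPair Manifold
open PowerSeries CongruenceSubgroup IsDedekindDomain IsDedekindDomain.HeightOneSpectrum Rat.HeightOneSpectrum
open WeierstrassCurve Literature.NumberTheory.DiophantineGeometry Literature.NumberTheory.EllipticCurves
  Literature.NumberTheory.EllipticCurves.ModularForms Literature.RingTheory.FormalGroups
open Summit.BirchSwinnertonDyer.Rank1Residual.ManinAdditive
open Summit.BirchSwinnertonDyer.Rank1Residual.ManinAdditive.CuspidalKummer
open Summit.BirchSwinnertonDyer.Rank1Residual.ManinAdditive.ShimuraLedger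
open Summit.BirchSwinnertonDyer.Rank1Residual.ManinAdditive.KatoCurve
open Summit.BirchSwinnertonDyer.Rank1Residual.ManinAdditive.KummerShimuraTwo
open Summit.BirchSwinnertonDyer.BirchSwinnertonDyer.Theorems.ManinLocalTwoThree.SigmaSquareRoot
open Summit.BirchSwinnertonDyer.BirchSwinnertonDyer.Theorems.ManinLocalTwoThree.SigmaHabitat
open Summit.BirchSwinnertonDyer.Rank1Residual.ManinAdditive.UDCKummerLineK

namespace Summit.BirchSwinnertonDyer.BirchSwinnertonDyer.Theorems.ManinLocalTwoThree.KernelSplit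

/-! ## §0 Index 4, made explicit -/

/-- At `4 ∣ N` (`2Λ₀(f) ⊆ Λ₁(f)`, Ling–Oesterlé): if `Λ₁(f) ≠ 2Λ₀(f)` then some `w ∈ Λ₁(f)` is not of the form `2v`, `v ∈ Λ₀(f)`.
[cite: LingOesterle1991, Thm. 6] -/
theorem exists_mem_periodLatticeGamma1_ne_two_mul_of_not_indexFour
    {V : WeierstrassCurve ℚ} [V.IsElliptic] {N : ℕ} [NeZero N] (D : ModularParametrizationData V N) (h4 : 2 ^ 2 ∣ N)
    (hidx : ¬ ∀ z : ℂ, z ∈ periodLatticeGamma1 D.f ↔ ∃ w ∈ periodLattice D.f, z = 2 * w) :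
    ∃ w ∈ periodLatticeGamma1 D.f, ∀ v ∈ periodLattice D.f, w ≠ 2 * v := by
  by_contra hno
  push Not at hno
  apply hidx
  intro z
  constructor
  · intro hz
    obtain ⟨v, hv, rfl⟩ := hno z hz
    exact ⟨v, hv, rfl⟩
  · rintro ⟨v, hv, rfl⟩
    exact two_mul_mem_periodLatticeGamma1_of_four_dvd D h4 hv

/-! ## §1 The datum-level composition with the kernel split -/

/-- **C2 LEVEL-WISE on the core, KERNEL split** (`4 ∣ N`): irreducible `W[2]` by F♯; `Λ₁(f) = Λ₀(f)` by `hEven`; on the gain locus `Λ₁(f) ≠ Λ₀(f)`: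
index `4` by `hI4N`, else a blind rational root by `hKN`, then a second rational root by `hTwoRootsN` (UDC₂ twice) or total blindness by the blind road
with `hKatoN` (6♭‴|_G).  CONDITIONAL reduction; nothing about BSD or Manin's conjecture is proved.
[cite: Kato2004Asterisque, Thm. 12.5 (1) (p. 221)] [cite: ConradEdixhovenStein2003, §6.1.2] [cite: Stevens1982, Thm. 1.3.1] [cite: Stevens1989, §2] -/
theorem not_two_dvd_maninConstant_of_kernelLawsG_core
    (hF : kato_neron_isIntegral_twistedSymbolSum_of_additive_two_real)
    (hFstar : optimalGamma1Parametrization_cusp_rational) (hFnat : optimalGamma1Parametrization_cuspZero_galoisConjugate)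
    (hex : exists_optimal_gamma1ParametrizationData)
    {N : ℕ} [NeZero N] (h4 : 2 ^ 2 ∣ N)
    (hEven : ∀ (V : WeierstrassCurve ℚ) [V.IsElliptic] [V.IsGloballyMinimal] (D : ModularParametrizationData V N),
      (∀ z ∈ D.L.lattice, ∃ w ∈ periodLattice D.f, z = D.c * w) →
      ∀ e : ℚ, V.twoTorsionPolynomial.toPoly.IsRoot e → (2 : ℤ) ∣ D.c → periodLatticeGamma1 D.f ≠ periodLattice D.f)
    (hTwoRootsN : ∀ (V : WeierstrassCurve ℚ) [V.IsElliptic] [V.IsGloballyMinimal] (D : ModularParametrizationData V N),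
      (∀ z ∈ D.L.lattice, ∃ w ∈ periodLattice D.f, z = D.c * w) →
      ∀ e e' : ℚ, V.twoTorsionPolynomial.toPoly.IsRoot e → V.twoTorsionPolynomial.toPoly.IsRoot e' → e ≠ e' →
      ¬ (∀ z : ℂ, z ∈ periodLatticeGamma1 D.f ↔ ∃ w ∈ periodLattice D.f, z = 2 * w) → ¬ (2 : ℤ) ∣ D.maninConstant)
    (hI4N : ∀ (V : WeierstrassCurve ℚ) [V.IsElliptic] [V.IsGloballyMinimal] (D : ModularParametrizationData V N),
      (∀ z ∈ D.L.lattice, ∃ w ∈ periodLattice D.f, z = D.c * w) →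
      ((primesEquiv (R := 𝓞 ℚ)).symm ⟨2, Nat.prime_two⟩).valuation ℚ V.j < 1 → (∀ d : ℤ, d = -1 ∨ d = 2 ∨ d = -2 → 2 ≤ (V.quadraticTwist (d : ℚ)).conductorExponent ((primesEquiv (R := ℤ)).symm ⟨2, Nat.prime_two⟩)) →
      modularSymbol D.f 0 ∉ periodLattice D.f → periodLatticeGamma1 D.f ≠ periodLattice D.f → V.a₁ = 0 → V.a₃ = 0 →
      ¬ (∀ z : ℂ, z ∈ periodLatticeGamma1 D.f ↔ ∃ w ∈ periodLattice D.f, z = 2 * w))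
    (hKN : ∀ (V : WeierstrassCurve ℚ) [V.IsElliptic] [V.IsGloballyMinimal] (D : ModularParametrizationData V N),
      (∀ z ∈ D.L.lattice, ∃ w ∈ periodLattice D.f, z = D.c * w) →
      ((primesEquiv (R := 𝓞 ℚ)).symm ⟨2, Nat.prime_two⟩).valuation ℚ V.j < 1 → (∀ d : ℤ, d = -1 ∨ d = 2 ∨ d = -2 → 2 ≤ (V.quadraticTwist (d : ℚ)).conductorExponent ((primesEquiv (R := ℤ)).symm ⟨2, Nat.prime_two⟩)) →
      modularSymbol D.f 0 ∉ periodLattice D.f → periodLatticeGamma1 D.f ≠ periodLattice D.f → V.a₁ = 0 → V.a₃ = 0 →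
      ¬ (∀ z : ℂ, z ∈ periodLatticeGamma1 D.f ↔ ∃ w ∈ periodLattice D.f, z = 2 * w) →
      ∃ A₂ A₄ E : ℤ, (A₂ : ℚ) = V.a₂ ∧ (A₄ : ℚ) = V.a₄ ∧
        (E : ℚ) ^ 3 + V.a₂ * (E : ℚ) ^ 2 + V.a₄ * E + V.a₆ = 0 ∧ KummerBlindAtTwo A₂ A₄ E)
    (hKatoN : ∀ (V : WeierstrassCurve ℚ) [V.IsElliptic] [V.IsGloballyMinimal] (D₁ : Gamma1ParametrizationData V N),
      D₁.IsOptimal → (∃ (W₀ : WeierstrassCurve ℚ) (_ : W₀.IsElliptic) (_ : W₀.IsGloballyMinimal) (D₀ : ModularParametrizationData W₀ N),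
        IsIsogenous V W₀ ∧ (∀ z ∈ D₀.L.lattice, ∃ w ∈ periodLattice D₀.f, z = D₀.c * w) ∧
        W₀.a₁ = 0 ∧ W₀.a₃ = 0 ∧ HasRationalTwoTorsion W₀ ∧ AllRationalTwoTorsionBlind W₀ ∧
        ((primesEquiv (R := 𝓞 ℚ)).symm ⟨2, Nat.prime_two⟩).valuation ℚ W₀.j < 1 ∧
        (∀ d : ℤ, d = -1 ∨ d = 2 ∨ d = -2 → 2 ≤ (W₀.quadraticTwist (d : ℚ)).conductorExponent ((primesEquiv (R := ℤ)).symm ⟨2, Nat.prime_two⟩)) ∧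
        modularSymbol D₀.f 0 ∉ periodLattice D₀.f ∧ periodLatticeGamma1 D₀.f ≠ periodLattice D₀.f) → KatoFactTwoAt V D₁.f)
    (W : WeierstrassCurve ℚ) [W.IsElliptic] [W.IsGloballyMinimal] (D : ModularParametrizationData W N)
    (hopt : ∀ z ∈ D.L.lattice, ∃ w ∈ periodLattice D.f, z = D.c * w)
    (hss : ((primesEquiv (R := 𝓞 ℚ)).symm ⟨2, Nat.prime_two⟩).valuation ℚ W.j < 1) (hcore : (∀ d : ℤ, d = -1 ∨ d = 2 ∨ d = -2 → 2 ≤ (W.quadraticTwist (d : ℚ)).conductorExponent ((primesEquiv (R := ℤ)).symm ⟨2, Nat.prime_two⟩))) :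
    ¬ (2 : ℤ) ∣ D.maninConstant := by
  by_cases hirr : W.HasIrreducibleModPGaloisRep 2
  · exact katoManinOddTwo_of_real_of_exists_gamma1 hF hex W D hopt h4 hirr
  have h4' : 4 ∣ N := by norm_num at h4; exact h4
  obtain ⟨h2, hN2⟩ := lFunction_two_eq_zero_of_four_dvd W D.isNewformOf h4'
  have hadd := hasAdditiveReductionAt_two_of_lFunction_two_eq_zero W h2 hN2
  obtain ⟨C, M, hu, hCW, hM1, hM3, hmin⟩ := exists_smul_eq_map_a₁_a₃_eq_zero_of_hasAdditiveReductionAt_two W hadd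
  haveI := hmin
  obtain ⟨D', hf, hc, hL, -⟩ := exists_modularParametrizationData_smul_of_u_eq_one W D C hu
  have hopt' : ∀ z ∈ D'.L.lattice, ∃ w ∈ periodLattice D'.f, z = D'.c * w := by
    rw [hL, hf, hc]; exact hopt
  have ha₁ : (C • W).a₁ = 0 := by rw [hCW, map_a₁, hM1, map_zero]
  have ha₃ : (C • W).a₃ = 0 := by rw [hCW, map_a₃, hM3, map_zero]
  have hssC : ((primesEquiv (R := 𝓞 ℚ)).symm ⟨2, Nat.prime_two⟩).valuation ℚ (C • W).j < 1 := by
    rw [variableChange_j]; exact hss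
  have hcoreC := twistCore_smul W C hcore
  suffices h : ¬ (2 : ℤ) ∣ D'.maninConstant by
    change ¬ (2 : ℤ) ∣ D'.c at h
    change ¬ (2 : ℤ) ∣ D.c
    rwa [hc] at h
  have hred' : ¬ (C • W).HasIrreducibleModPGaloisRep 2 := by
    rwa [Mazur1978.hasIrreducibleModPGaloisRep_smul_iff]
  by_cases hΛ : periodLatticeGamma1 D'.f = periodLattice D'.f
  · -- STEVENS' CURVE = THE OPTIMAL CURVE (`Λ₁ = Λ₀`): an even `c` would force `Λ₁ ≠ Λ₀`
    obtain ⟨e, he⟩ := exists_isRoot_twoTorsionPolynomial_of_not_hasIrreducibleModPGaloisRep_two (C • W) hred'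
    exact fun h2 ↦ hEven (C • W) D' hopt' e he h2 hΛ
  · -- THE GAIN LOCUS `Λ₁ ≠ Λ₀`
    have h0 : modularSymbol D'.f 0 ∉ periodLattice D'.f := modularSymbol_zero_not_mem_of_ne_of_print hFstar hFnat hex D' hopt' hΛ
    intro h2
    -- index 4 is excluded by the row I4
    have hidx := hI4N (C • W) D' hopt' hssC hcoreC h0 hΛ ha₁ ha₃
    -- so the row K♭ gives a BLIND rational root `E`
    obtain ⟨A₂, A₄, E, hA₂, hA₄, hE, hbl⟩ := hKN (C • W) D' hopt' hssC hcoreC h0 hΛ ha₁ ha₃ hidx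
    have hErt : (C • W).twoTorsionPolynomial.toPoly.IsRoot (E : ℚ) := (isRoot_twoTorsionPolynomial_iff_of_a₁_a₃ (C • W) ha₁ ha₃ _).mpr hE
    by_cases hsec : ∃ e : ℚ, (C • W).twoTorsionPolynomial.toPoly.IsRoot e ∧ e ≠ (E : ℚ)
    · -- a SECOND rational root: UDC₂ twice forces index 4
      obtain ⟨e, he, hne⟩ := hsec
      exact hTwoRootsN (C • W) D' hopt' e E he hErt hne hidx h2
    · -- `E` is the only rational root: the curve is totally blind — the blind road with 6♭‴|_G
      push Not at hsec
      have hall : AllRationalTwoTorsionBlind (C • W) := fun e he ↦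
        ⟨A₂, A₄, E, hA₂, hA₄, (hsec e ((isRoot_twoTorsionPolynomial_iff_of_a₁_a₃ (C • W) ha₁ ha₃ e).mpr he)).symm, hbl⟩
      have hT : HasRationalTwoTorsion (C • W) := ⟨E, hE⟩
      obtain ⟨W₁, i₁, i₂, D₁, hiso, hD₁⟩ := hex (C • W) D' hopt'
      have hKato : KatoFactTwoAt W₁ D₁.f :=
        hKatoN W₁ D₁ hD₁ ⟨C • W, inferInstance, hmin, D', hiso, hopt', ha₁, ha₃, hT, hall, hssC, hcoreC, h0, hΛ⟩
      exact not_two_dvd_maninConstant_of_katoFactAt₁_of_allBlind hFstar W₁ (C • W) D₁ D' hiso hD₁ hopt' h4 ha₁ ha₃ hall hKato h2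

/-! ## §2 The `16 ∣ N` core form and the route decl from abstract inputs -/

/-- **C2 on the core ∩ {`16 ∣ N`} ⟸ F♯ ∧ F★ ∧ F♮ ∧ CES ∧ F-es-21♭K ∧ `hEven` ∧ `hTwoRoots` ∧ the three kernel-split rows on the gain locus** (§1 + the
period-recut dispatcher of `…ManinOddAtSixteenOfStubs`, as in v25/v26).  CONDITIONAL. [cite: Kato2004Asterisque, Thm. 12.5 (1) (p. 221)] [cite: Stevens1989, §2] -/
theorem maninOddAtSixteenCore_of_v27
    (hF : kato_neron_isIntegral_twistedSymbolSum_of_additive_two_real)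
    (hFstar : optimalGamma1Parametrization_cusp_rational) (hFnat : optimalGamma1Parametrization_cuspZero_galoisConjugate)
    (hex : exists_optimal_gamma1ParametrizationData) (hK : kato_isIntegral_twistedSymbolSum_two_symbolClosure)
    (hEven : ∀ (W : WeierstrassCurve ℚ) [W.IsElliptic] [W.IsGloballyMinimal] {N : ℕ} [NeZero N] (D : ModularParametrizationData W N),
      2 ^ 4 ∣ N → (∀ z ∈ D.L.lattice, ∃ w ∈ periodLattice D.f, z = D.c * w) →
      ∀ e : ℚ, W.twoTorsionPolynomial.toPoly.IsRoot e → (2 : ℤ) ∣ D.c → periodLatticeGamma1 D.f ≠ periodLattice D.f)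
    (hTwoRoots : ∀ (W : WeierstrassCurve ℚ) [W.IsElliptic] [W.IsGloballyMinimal] {N : ℕ} [NeZero N] (D : ModularParametrizationData W N),
      2 ^ 4 ∣ N → (∀ z ∈ D.L.lattice, ∃ w ∈ periodLattice D.f, z = D.c * w) →
      ∀ e e' : ℚ, W.twoTorsionPolynomial.toPoly.IsRoot e → W.twoTorsionPolynomial.toPoly.IsRoot e' → e ≠ e' →
      ¬ (∀ z : ℂ, z ∈ periodLatticeGamma1 D.f ↔ ∃ w ∈ periodLattice D.f, z = 2 * w) → ¬ (2 : ℤ) ∣ D.maninConstant)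
    (hI4 : ∀ (W : WeierstrassCurve ℚ) [W.IsElliptic] [W.IsGloballyMinimal] {N : ℕ} [NeZero N] (D : ModularParametrizationData W N),
      2 ^ 4 ∣ N → (∀ z ∈ D.L.lattice, ∃ w ∈ periodLattice D.f, z = D.c * w) →
      ((primesEquiv (R := 𝓞 ℚ)).symm ⟨2, Nat.prime_two⟩).valuation ℚ W.j < 1 →
      (∀ d : ℤ, d = -1 ∨ d = 2 ∨ d = -2 → 2 ≤ (W.quadraticTwist (d : ℚ)).conductorExponent ((primesEquiv (R := ℤ)).symm ⟨2, Nat.prime_two⟩)) →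
      modularSymbol D.f 0 ∉ periodLattice D.f → periodLatticeGamma1 D.f ≠ periodLattice D.f → W.a₁ = 0 → W.a₃ = 0 →
      ¬ (∀ z : ℂ, z ∈ periodLatticeGamma1 D.f ↔ ∃ w ∈ periodLattice D.f, z = 2 * w))
    (hK152 : ∀ (W : WeierstrassCurve ℚ) [W.IsElliptic] [W.IsGloballyMinimal] {N : ℕ} [NeZero N] (D : ModularParametrizationData W N),
      2 ^ 4 ∣ N → (∀ z ∈ D.L.lattice, ∃ w ∈ periodLattice D.f, z = D.c * w) →
      ((primesEquiv (R := 𝓞 ℚ)).symm ⟨2, Nat.prime_two⟩).valuation ℚ W.j < 1 →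
      (∀ d : ℤ, d = -1 ∨ d = 2 ∨ d = -2 → 2 ≤ (W.quadraticTwist (d : ℚ)).conductorExponent ((primesEquiv (R := ℤ)).symm ⟨2, Nat.prime_two⟩)) →
      modularSymbol D.f 0 ∉ periodLattice D.f → periodLatticeGamma1 D.f ≠ periodLattice D.f → W.a₁ = 0 → W.a₃ = 0 →
      ¬ (∀ z : ℂ, z ∈ periodLatticeGamma1 D.f ↔ ∃ w ∈ periodLattice D.f, z = 2 * w) →
      ∃ A₂ A₄ E : ℤ, (A₂ : ℚ) = W.a₂ ∧ (A₄ : ℚ) = W.a₄ ∧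
        (E : ℚ) ^ 3 + W.a₂ * (E : ℚ) ^ 2 + W.a₄ * E + W.a₆ = 0 ∧ KummerBlindAtTwo A₂ A₄ E)
    (h110 : ∀ (V : WeierstrassCurve ℚ) [V.IsElliptic] [V.IsGloballyMinimal] {N : ℕ} [NeZero N]
      (D₁ : Gamma1ParametrizationData V N), D₁.IsOptimal → 2 ^ 4 ∣ N →
      (¬ ∃ (V' : WeierstrassCurve ℚ) (_ : V'.IsElliptic) (_ : V'.IsGloballyMinimal) (q m : ℤ),
        Odd q ∧ WeierstrassCurve.IsIsogenous V' V ∧ (q : ℝ) * V'.realPeriodRat = (m : ℝ) * V.realPeriodRat ∧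
        IsSymbolClosureCurve V' D₁.f) →
      (∃ (W₀ : WeierstrassCurve ℚ) (_ : W₀.IsElliptic) (_ : W₀.IsGloballyMinimal) (D₀ : ModularParametrizationData W₀ N),
        IsIsogenous V W₀ ∧ (∀ z ∈ D₀.L.lattice, ∃ w ∈ periodLattice D₀.f, z = D₀.c * w) ∧
        W₀.a₁ = 0 ∧ W₀.a₃ = 0 ∧ HasRationalTwoTorsion W₀ ∧ AllRationalTwoTorsionBlind W₀ ∧
        ((primesEquiv (R := 𝓞 ℚ)).symm ⟨2, Nat.prime_two⟩).valuation ℚ W₀.j < 1 ∧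
        (∀ d : ℤ, d = -1 ∨ d = 2 ∨ d = -2 → 2 ≤ (W₀.quadraticTwist (d : ℚ)).conductorExponent ((primesEquiv (R := ℤ)).symm ⟨2, Nat.prime_two⟩)) ∧
        modularSymbol D₀.f 0 ∉ periodLattice D₀.f ∧ periodLatticeGamma1 D₀.f ≠ periodLattice D₀.f) →
      KatoFactTwoAt V D₁.f)
    :
    mazur_not_dvd_maninConstant_of_odd → abbesUllmo_not_dvd_maninConstant_of_not_dvd_level →
      cesnavicius_not_two_dvd_maninConstant_of_two_dvd_level → exists_isNewformOf →
      ∀ (W : WeierstrassCurve ℚ) [W.IsElliptic] [W.IsGloballyMinimal] {N : ℕ} [NeZero N] (D : ModularParametrizationData W N),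
        (∀ z ∈ D.L.lattice, ∃ w ∈ periodLattice D.f, z = D.c * w) → 2 ^ 4 ∣ N →
        ((primesEquiv (R := 𝓞 ℚ)).symm ⟨2, Nat.prime_two⟩).valuation ℚ W.j < 1 →
        (∀ d : ℤ, d = -1 ∨ d = 2 ∨ d = -2 → 2 ≤ (W.quadraticTwist (d : ℚ)).conductorExponent ((primesEquiv (R := ℤ)).symm ⟨2, Nat.prime_two⟩)) →
        ¬ (2 : ℤ) ∣ D.maninConstant := by
  intro _hMz _hAU _hCs _hnf W _ _ N _ D hopt h16 hss hcore
  have h4 : 2 ^ 2 ∣ N := dvd_trans ⟨4, by norm_num⟩ h16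
  exact not_two_dvd_maninConstant_of_kernelLawsG_core hF hFstar hFnat hex h4
    (fun V _ _ D' hopt' e he h2 => hEven V D' h16 hopt' e he h2)
    (fun V _ _ D' hopt' e e' he he' hne hidx => hTwoRoots V D' h16 hopt' e e' he he' hne hidx)
    (fun V _ _ D' hopt' hssV hcV h0 hΛ h1 h3 => hI4 V D' h16 hopt' hssV hcV h0 hΛ h1 h3)
    (fun V _ _ D' hopt' hssV hcV h0 hΛ h1 h3 hidx => hK152 V D' h16 hopt' hssV hcV h0 hΛ h1 h3 hidx)
    (fun V _ _ D₁ hD₁ hguard =>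
      katoFactTwoAt_of_symbolClosure_of_periodRecut hK h4 V D₁ (fun hno => h110 V D₁ hD₁ h16 hno hguard)) W D hopt hss hcore

/-- **THE ROUTE DECL `Theses.ManinLocalTwoThree.ManinOddAtFour` from the abstract v27 inputs** (§2, the binder-preserving rotation of `…SixteenSplitCore` and
p2's `maninOddAtFour_of_core`, as in v25/v26).  CONDITIONAL reduction; C2, Manin's conjecture and BSD are NOT proved.
[cite: Kato2004Asterisque, Thm. 12.5 (1) (p. 221)] [cite: ConradEdixhovenStein2003, §6.1.2 and §6.2] [cite: Stevens1982, Thm. 1.3.1] [cite: Stevens1989, §2] -/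
theorem maninOddAtFour_of_katoFact_udcTwo_kernelLawsG
    (hF : kato_neron_isIntegral_twistedSymbolSum_of_additive_two_real)
    (hFstar : optimalGamma1Parametrization_cusp_rational) (hFnat : optimalGamma1Parametrization_cuspZero_galoisConjugate)
    (hex : exists_optimal_gamma1ParametrizationData) (hK : kato_isIntegral_twistedSymbolSum_two_symbolClosure)
    (hEven : ∀ (W : WeierstrassCurve ℚ) [W.IsElliptic] [W.IsGloballyMinimal] {N : ℕ} [NeZero N] (D : ModularParametrizationData W N),
      2 ^ 4 ∣ N → (∀ z ∈ D.L.lattice, ∃ w ∈ periodLattice D.f, z = D.c * w) →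
      ∀ e : ℚ, W.twoTorsionPolynomial.toPoly.IsRoot e → (2 : ℤ) ∣ D.c → periodLatticeGamma1 D.f ≠ periodLattice D.f)
    (hTwoRoots : ∀ (W : WeierstrassCurve ℚ) [W.IsElliptic] [W.IsGloballyMinimal] {N : ℕ} [NeZero N] (D : ModularParametrizationData W N),
      2 ^ 4 ∣ N → (∀ z ∈ D.L.lattice, ∃ w ∈ periodLattice D.f, z = D.c * w) →
      ∀ e e' : ℚ, W.twoTorsionPolynomial.toPoly.IsRoot e → W.twoTorsionPolynomial.toPoly.IsRoot e' → e ≠ e' →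
      ¬ (∀ z : ℂ, z ∈ periodLatticeGamma1 D.f ↔ ∃ w ∈ periodLattice D.f, z = 2 * w) → ¬ (2 : ℤ) ∣ D.maninConstant)
    (hI4 : ∀ (W : WeierstrassCurve ℚ) [W.IsElliptic] [W.IsGloballyMinimal] {N : ℕ} [NeZero N] (D : ModularParametrizationData W N),
      2 ^ 4 ∣ N → (∀ z ∈ D.L.lattice, ∃ w ∈ periodLattice D.f, z = D.c * w) →
      ((primesEquiv (R := 𝓞 ℚ)).symm ⟨2, Nat.prime_two⟩).valuation ℚ W.j < 1 →
      (∀ d : ℤ, d = -1 ∨ d = 2 ∨ d = -2 → 2 ≤ (W.quadraticTwist (d : ℚ)).conductorExponent ((primesEquiv (R := ℤ)).symm ⟨2, Nat.prime_two⟩)) →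
      modularSymbol D.f 0 ∉ periodLattice D.f → periodLatticeGamma1 D.f ≠ periodLattice D.f → W.a₁ = 0 → W.a₃ = 0 →
      ¬ (∀ z : ℂ, z ∈ periodLatticeGamma1 D.f ↔ ∃ w ∈ periodLattice D.f, z = 2 * w))
    (hK152 : ∀ (W : WeierstrassCurve ℚ) [W.IsElliptic] [W.IsGloballyMinimal] {N : ℕ} [NeZero N] (D : ModularParametrizationData W N),
      2 ^ 4 ∣ N → (∀ z ∈ D.L.lattice, ∃ w ∈ periodLattice D.f, z = D.c * w) →
      ((primesEquiv (R := 𝓞 ℚ)).symm ⟨2, Nat.prime_two⟩).valuation ℚ W.j < 1 →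
      (∀ d : ℤ, d = -1 ∨ d = 2 ∨ d = -2 → 2 ≤ (W.quadraticTwist (d : ℚ)).conductorExponent ((primesEquiv (R := ℤ)).symm ⟨2, Nat.prime_two⟩)) →
      modularSymbol D.f 0 ∉ periodLattice D.f → periodLatticeGamma1 D.f ≠ periodLattice D.f → W.a₁ = 0 → W.a₃ = 0 →
      ¬ (∀ z : ℂ, z ∈ periodLatticeGamma1 D.f ↔ ∃ w ∈ periodLattice D.f, z = 2 * w) →
      ∃ A₂ A₄ E : ℤ, (A₂ : ℚ) = W.a₂ ∧ (A₄ : ℚ) = W.a₄ ∧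
        (E : ℚ) ^ 3 + W.a₂ * (E : ℚ) ^ 2 + W.a₄ * E + W.a₆ = 0 ∧ KummerBlindAtTwo A₂ A₄ E)
    (h110 : ∀ (V : WeierstrassCurve ℚ) [V.IsElliptic] [V.IsGloballyMinimal] {N : ℕ} [NeZero N]
      (D₁ : Gamma1ParametrizationData V N), D₁.IsOptimal → 2 ^ 4 ∣ N →
      (¬ ∃ (V' : WeierstrassCurve ℚ) (_ : V'.IsElliptic) (_ : V'.IsGloballyMinimal) (q m : ℤ),
        Odd q ∧ WeierstrassCurve.IsIsogenous V' V ∧ (q : ℝ) * V'.realPeriodRat = (m : ℝ) * V.realPeriodRat ∧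
        IsSymbolClosureCurve V' D₁.f) →
      (∃ (W₀ : WeierstrassCurve ℚ) (_ : W₀.IsElliptic) (_ : W₀.IsGloballyMinimal) (D₀ : ModularParametrizationData W₀ N),
        IsIsogenous V W₀ ∧ (∀ z ∈ D₀.L.lattice, ∃ w ∈ periodLattice D₀.f, z = D₀.c * w) ∧
        W₀.a₁ = 0 ∧ W₀.a₃ = 0 ∧ HasRationalTwoTorsion W₀ ∧ AllRationalTwoTorsionBlind W₀ ∧
        ((primesEquiv (R := 𝓞 ℚ)).symm ⟨2, Nat.prime_two⟩).valuation ℚ W₀.j < 1 ∧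
        (∀ d : ℤ, d = -1 ∨ d = 2 ∨ d = -2 → 2 ≤ (W₀.quadraticTwist (d : ℚ)).conductorExponent ((primesEquiv (R := ℤ)).symm ⟨2, Nat.prime_two⟩)) ∧
        modularSymbol D₀.f 0 ∉ periodLattice D₀.f ∧ periodLatticeGamma1 D₀.f ≠ periodLattice D₀.f) →
      KatoFactTwoAt V D₁.f)
    : Summit.BirchSwinnertonDyer.BirchSwinnertonDyer.Theses.ManinLocalTwoThree.ManinOddAtFour :=
  maninOddAtFour_of_core
    (maninOddAtFourCore_of_maninOddAtSixteenCore
      (maninOddAtSixteenCore_of_v27 hF hFstar hFnat hex hK hEven hTwoRoots hI4 hK152 h110))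

/-! ## §3 The rows from -an's NAMED B-rows, and the instantiation (UDC₂ = p2's AN2₂ theorem + CDT) -/

/-- **E-an-152b|_B ⟹ I4 (the `16 ∣ N` gain-locus form)**: restriction (the extra binders are dropped). [cite: Stevens1989, §2] -/
theorem indexNeFourG_of_B (h : ShimuraIndexNeFourAtFourB) :
    ∀ (W : WeierstrassCurve ℚ) [W.IsElliptic] [W.IsGloballyMinimal] {N : ℕ} [NeZero N] (D : ModularParametrizationData W N),
      2 ^ 4 ∣ N → (∀ z ∈ D.L.lattice, ∃ w ∈ periodLattice D.f, z = D.c * w) →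
      ((primesEquiv (R := 𝓞 ℚ)).symm ⟨2, Nat.prime_two⟩).valuation ℚ W.j < 1 →
      (∀ d : ℤ, d = -1 ∨ d = 2 ∨ d = -2 → 2 ≤ (W.quadraticTwist (d : ℚ)).conductorExponent ((primesEquiv (R := ℤ)).symm ⟨2, Nat.prime_two⟩)) →
      modularSymbol D.f 0 ∉ periodLattice D.f → periodLatticeGamma1 D.f ≠ periodLattice D.f → W.a₁ = 0 → W.a₃ = 0 →
      ¬ (∀ z : ℂ, z ∈ periodLatticeGamma1 D.f ↔ ∃ w ∈ periodLattice D.f, z = 2 * w) :=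
  fun W _ _ _N _ D h16 hopt _hss _hcore h0 _hΛ _h1 _h3 ↦ h W D hopt (dvd_trans ⟨4, by norm_num⟩ h16) h0

/-- **E-an-152|_B ⟹ K♭ (the `16 ∣ N` gain-locus form, `℘`-clause dropped)**: at index `≠ 4` some `w ∈ Λ₁(f) ∖ 2Λ₀(f)` exists (§0), and -an's row makes
the `2`-torsion point `u₀(c₀w/2)` a BLIND rational root. [cite: Stevens1989, §2] [cite: LingOesterle1991, Thm. 6] -/
theorem blindRootG_of_kernelBlindB (h : ShimuraKernelBlindAtFourB) :
    ∀ (W : WeierstrassCurve ℚ) [W.IsElliptic] [W.IsGloballyMinimal] {N : ℕ} [NeZero N] (D : ModularParametrizationData W N),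
      2 ^ 4 ∣ N → (∀ z ∈ D.L.lattice, ∃ w ∈ periodLattice D.f, z = D.c * w) →
      ((primesEquiv (R := 𝓞 ℚ)).symm ⟨2, Nat.prime_two⟩).valuation ℚ W.j < 1 →
      (∀ d : ℤ, d = -1 ∨ d = 2 ∨ d = -2 → 2 ≤ (W.quadraticTwist (d : ℚ)).conductorExponent ((primesEquiv (R := ℤ)).symm ⟨2, Nat.prime_two⟩)) →
      modularSymbol D.f 0 ∉ periodLattice D.f → periodLatticeGamma1 D.f ≠ periodLattice D.f → W.a₁ = 0 → W.a₃ = 0 →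
      ¬ (∀ z : ℂ, z ∈ periodLatticeGamma1 D.f ↔ ∃ w ∈ periodLattice D.f, z = 2 * w) →
      ∃ A₂ A₄ E : ℤ, (A₂ : ℚ) = W.a₂ ∧ (A₄ : ℚ) = W.a₄ ∧
        (E : ℚ) ^ 3 + W.a₂ * (E : ℚ) ^ 2 + W.a₄ * E + W.a₆ = 0 ∧ KummerBlindAtTwo A₂ A₄ E := by
  intro W _ _ N _ D h16 hopt _hss _hcore h0 hΛ h1 h3 hidx
  have h4 : 2 ^ 2 ∣ N := dvd_trans ⟨4, by norm_num⟩ h16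
  obtain ⟨w, hw, hw2⟩ := exists_mem_periodLatticeGamma1_ne_two_mul_of_not_indexFour D h4 hidx
  obtain ⟨A₂, A₄, E, hA₂, hA₄, hE, -, hbl⟩ := h W D hopt h4 h0 h1 h3 hΛ w hw hw2
  exact ⟨A₂, A₄, E, hA₂, hA₄, hE, hbl⟩

/-- **THE ROUTE DECL BY NAME from the v27-candidate inputs**: F♯, F★, F♮, CES, F-es-21♭K, CDT-algInt (PRINTED) and the OPEN rows {I4 = E-an-152b|_G, K♭ = E-an-152♭|_G,
6♭‴|_G} stated INLINE (the v27 skeleton's stubs).  `hEven` := p2's `UDCTwo.periodLatticeGamma1_ne_of_two_dvd_of_CDT_algInt`; `hTwoRoots` := the LEAD's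
`FullTwoTorsion.not_two_dvd_maninConstant_of_two_roots_of_not_indexFour` on p2's AN2₂ THEOREM `UDCTwo.sqRootWitnessLaw` and UDW ⟸ CDT.  CONDITIONAL reduction;
C2, Manin's conjecture and BSD are NOT proved. [cite: CalegariDimitrovTang2025, Thm. 1.0.1 and Remarks 58–59] [cite: KurthLong2008, Prop. 18]
[cite: Kato2004Asterisque, Thm. 12.5 (1) (p. 221)] [cite: Stevens1989, §2] -/
theorem maninOddAtFour_of_katoFact_CDT_kernelLawsG
    (hF : kato_neron_isIntegral_twistedSymbolSum_of_additive_two_real)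
    (hFstar : optimalGamma1Parametrization_cusp_rational) (hFnat : optimalGamma1Parametrization_cuspZero_galoisConjugate)
    (hex : exists_optimal_gamma1ParametrizationData) (hK : kato_isIntegral_twistedSymbolSum_two_symbolClosure)
    (hCDT : Literature.NumberTheory.Automorphic.CalegariDimitrovTang2025_unboundedDenominators_algInt)
    (hI4 : ∀ (W : WeierstrassCurve ℚ) [W.IsElliptic] [W.IsGloballyMinimal] {N : ℕ} [NeZero N] (D : ModularParametrizationData W N),
      2 ^ 4 ∣ N → (∀ z ∈ D.L.lattice, ∃ w ∈ periodLattice D.f, z = D.c * w) →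
      ((primesEquiv (R := 𝓞 ℚ)).symm ⟨2, Nat.prime_two⟩).valuation ℚ W.j < 1 →
      (∀ d : ℤ, d = -1 ∨ d = 2 ∨ d = -2 → 2 ≤ (W.quadraticTwist (d : ℚ)).conductorExponent ((primesEquiv (R := ℤ)).symm ⟨2, Nat.prime_two⟩)) →
      modularSymbol D.f 0 ∉ periodLattice D.f → periodLatticeGamma1 D.f ≠ periodLattice D.f → W.a₁ = 0 → W.a₃ = 0 →
      ¬ (∀ z : ℂ, z ∈ periodLatticeGamma1 D.f ↔ ∃ w ∈ periodLattice D.f, z = 2 * w))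
    (hK152 : ∀ (W : WeierstrassCurve ℚ) [W.IsElliptic] [W.IsGloballyMinimal] {N : ℕ} [NeZero N] (D : ModularParametrizationData W N),
      2 ^ 4 ∣ N → (∀ z ∈ D.L.lattice, ∃ w ∈ periodLattice D.f, z = D.c * w) →
      ((primesEquiv (R := 𝓞 ℚ)).symm ⟨2, Nat.prime_two⟩).valuation ℚ W.j < 1 →
      (∀ d : ℤ, d = -1 ∨ d = 2 ∨ d = -2 → 2 ≤ (W.quadraticTwist (d : ℚ)).conductorExponent ((primesEquiv (R := ℤ)).symm ⟨2, Nat.prime_two⟩)) →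
      modularSymbol D.f 0 ∉ periodLattice D.f → periodLatticeGamma1 D.f ≠ periodLattice D.f → W.a₁ = 0 → W.a₃ = 0 →
      ¬ (∀ z : ℂ, z ∈ periodLatticeGamma1 D.f ↔ ∃ w ∈ periodLattice D.f, z = 2 * w) →
      ∃ A₂ A₄ E : ℤ, (A₂ : ℚ) = W.a₂ ∧ (A₄ : ℚ) = W.a₄ ∧
        (E : ℚ) ^ 3 + W.a₂ * (E : ℚ) ^ 2 + W.a₄ * E + W.a₆ = 0 ∧ KummerBlindAtTwo A₂ A₄ E)
    (h110 : ∀ (V : WeierstrassCurve ℚ) [V.IsElliptic] [V.IsGloballyMinimal] {N : ℕ} [NeZero N]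
      (D₁ : Gamma1ParametrizationData V N), D₁.IsOptimal → 2 ^ 4 ∣ N →
      (¬ ∃ (V' : WeierstrassCurve ℚ) (_ : V'.IsElliptic) (_ : V'.IsGloballyMinimal) (q m : ℤ),
        Odd q ∧ WeierstrassCurve.IsIsogenous V' V ∧ (q : ℝ) * V'.realPeriodRat = (m : ℝ) * V.realPeriodRat ∧
        IsSymbolClosureCurve V' D₁.f) →
      (∃ (W₀ : WeierstrassCurve ℚ) (_ : W₀.IsElliptic) (_ : W₀.IsGloballyMinimal) (D₀ : ModularParametrizationData W₀ N),
        IsIsogenous V W₀ ∧ (∀ z ∈ D₀.L.lattice, ∃ w ∈ periodLattice D₀.f, z = D₀.c * w) ∧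
        W₀.a₁ = 0 ∧ W₀.a₃ = 0 ∧ HasRationalTwoTorsion W₀ ∧ AllRationalTwoTorsionBlind W₀ ∧
        ((primesEquiv (R := 𝓞 ℚ)).symm ⟨2, Nat.prime_two⟩).valuation ℚ W₀.j < 1 ∧
        (∀ d : ℤ, d = -1 ∨ d = 2 ∨ d = -2 → 2 ≤ (W₀.quadraticTwist (d : ℚ)).conductorExponent ((primesEquiv (R := ℤ)).symm ⟨2, Nat.prime_two⟩)) ∧
        modularSymbol D₀.f 0 ∉ periodLattice D₀.f ∧ periodLatticeGamma1 D₀.f ≠ periodLattice D₀.f) →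
      KatoFactTwoAt V D₁.f)
    : Summit.BirchSwinnertonDyer.BirchSwinnertonDyer.Theses.ManinLocalTwoThree.ManinOddAtFour :=
  maninOddAtFour_of_katoFact_udcTwo_kernelLawsG hF hFstar hFnat hex hK
    (fun W _ _ N _ D h16 hopt e he h2 ↦
      UDCTwo.periodLatticeGamma1_ne_of_two_dvd_of_CDT_algInt hCDT W D (dvd_trans ⟨4, by norm_num⟩ h16) hopt he h2)
    (fun W _ _ N _ D h16 hopt e e' he he' hne hidx ↦
      FullTwoTorsion.not_two_dvd_maninConstant_of_two_roots_of_not_indexFour UDCTwo.sqRootWitnessLaw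
        (fun k ↦ UDWOfCDT.unboundedDenominatorsWeightAlgInt_of_CDT_algInt hCDT k) D (dvd_trans ⟨4, by norm_num⟩ h16) hopt he he' hne hidx)
    hI4 hK152 h110

/-- **THE ROUTE DECL BY NAME from -an's NAMED rows**: F♯, F★, F♮, CES, F-es-21♭K, CDT-algInt (PRINTED) and the OPEN rows `KummerShimuraTwo.ShimuraIndexNeFourAtFourB`
(E-an-152b|_B), `KummerShimuraTwo.ShimuraKernelBlindAtFourB` (E-an-152|_B) — both STRONGER than the G-forms consumed — and 6♭‴|_G inline.  CONDITIONAL reduction;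
C2, Manin's conjecture and BSD are NOT proved. [cite: Stevens1989, §2] [cite: CalegariDimitrovTang2025, Thm. 1.0.1] [cite: Kato2004Asterisque, Thm. 12.5 (1) (p. 221)] -/
theorem maninOddAtFour_of_katoFact_CDT_kernelRowsB
    (hF : kato_neron_isIntegral_twistedSymbolSum_of_additive_two_real)
    (hFstar : optimalGamma1Parametrization_cusp_rational) (hFnat : optimalGamma1Parametrization_cuspZero_galoisConjugate)
    (hex : exists_optimal_gamma1ParametrizationData) (hK : kato_isIntegral_twistedSymbolSum_two_symbolClosure)
    (hCDT : Literature.NumberTheory.Automorphic.CalegariDimitrovTang2025_unboundedDenominators_algInt)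
    (h152b : ShimuraIndexNeFourAtFourB) (h152 : ShimuraKernelBlindAtFourB)
    (h110 : ∀ (V : WeierstrassCurve ℚ) [V.IsElliptic] [V.IsGloballyMinimal] {N : ℕ} [NeZero N]
      (D₁ : Gamma1ParametrizationData V N), D₁.IsOptimal → 2 ^ 4 ∣ N →
      (¬ ∃ (V' : WeierstrassCurve ℚ) (_ : V'.IsElliptic) (_ : V'.IsGloballyMinimal) (q m : ℤ),
        Odd q ∧ WeierstrassCurve.IsIsogenous V' V ∧ (q : ℝ) * V'.realPeriodRat = (m : ℝ) * V.realPeriodRat ∧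
        IsSymbolClosureCurve V' D₁.f) →
      (∃ (W₀ : WeierstrassCurve ℚ) (_ : W₀.IsElliptic) (_ : W₀.IsGloballyMinimal) (D₀ : ModularParametrizationData W₀ N),
        IsIsogenous V W₀ ∧ (∀ z ∈ D₀.L.lattice, ∃ w ∈ periodLattice D₀.f, z = D₀.c * w) ∧
        W₀.a₁ = 0 ∧ W₀.a₃ = 0 ∧ HasRationalTwoTorsion W₀ ∧ AllRationalTwoTorsionBlind W₀ ∧
        ((primesEquiv (R := 𝓞 ℚ)).symm ⟨2, Nat.prime_two⟩).valuation ℚ W₀.j < 1 ∧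
        (∀ d : ℤ, d = -1 ∨ d = 2 ∨ d = -2 → 2 ≤ (W₀.quadraticTwist (d : ℚ)).conductorExponent ((primesEquiv (R := ℤ)).symm ⟨2, Nat.prime_two⟩)) ∧
        modularSymbol D₀.f 0 ∉ periodLattice D₀.f ∧ periodLatticeGamma1 D₀.f ≠ periodLattice D₀.f) →
      KatoFactTwoAt V D₁.f)
    : Summit.BirchSwinnertonDyer.BirchSwinnertonDyer.Theses.ManinLocalTwoThree.ManinOddAtFour :=
  maninOddAtFour_of_katoFact_CDT_kernelLawsG hF hFstar hFnat hex hK hCDT (indexNeFourG_of_B h152b) (blindRootG_of_kernelBlindB h152) h110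

end Summit.BirchSwinnertonDyer.BirchSwinnertonDyer.Theorems.ManinLocalTwoThree.KernelSplit

end
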